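import Literature.Geometry.Manifold.BilinSectionTransport
import HarnessLib

/-!
# Pulling back a smooth FAMILY of fields of bilinear forms along a fixed map between manifolds

Topic `Literature/Geometry/Manifold` (namespace `Literature.Geometry.Manifold`). The parametric
companion of `PseudoRiemannianMetric.contMDiff_pullbackBilin_section` (`InitialDataPullback.lean`) and
of `contMDiffAt_pullbackBilin_of_contMDiffAt` (`BilinSectionTransport.lean`), and the general-target
version of `contMDiffAt_pullbackBilin_family` (`BilinFamilyPullback.lean`, where the target is a vector
space): here the target is an arbitrary manifold `M`, the fields of bilinear forms on `TM` come in a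
family `s p` indexed by a parameter `p` in a manifold `P`, jointly `C^n` in `(p, x)` as a map into the
bundle `Hom(TM, Hom(TM, ℝ))`, and `f : N → M` is a fixed map, `C^{n+1}` at `y₀`. Then

* `contMDiffAt_pullbackBilin_familySection` — `(p, y) ↦ (y, (f^*(s p))_y)` is `C^n` at `(p₀, y₀)` as a
  map `P × N → Hom(TN, Hom(TN, ℝ))`: in tangent coordinates `f^*(s p) = Φᵀ (β p ∘ f) Φ`, `Φ` the
  differential of `f` read in charts (`ContMDiffAt.mfderiv_const`), `β` the family read in charts
  (`contMDiffAt_bilin_iff`);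
* `contDiffAt_pullbackBilin_familySection` — when the source `N = F'` and the parameter space `P'` are
  normed spaces (identity trivialisations, `symmL_trivializationAt_self`), the same family is `C^n` at
  `(p₀, z₀)` as a FUNCTION `P' × F' → (F' →L F' →L ℝ)`.

This is the smoothness-in-parameters of reading a smooth family of tensors through a fixed chart or
immersion (O'Neill 1983, Ch. 3, Def. 3.9; Lee 2013, Prop. 13.3 pattern), used for families of initial
data deformed by a fixed family of diffeomorphisms (`AFEndBreathingFamily.lean`). Everything is proved;
no definitions, no named facts.

## References

* B. O'Neill, *Semi-Riemannian geometry* (1983), Ch. 3, Def. 3.9 and Lemma 3.35. [ONeill1983]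
* J. M. Lee, *Introduction to Smooth Manifolds*, 2nd ed. (2013), Prop. 13.3. [LeeSmoothManifolds2013]
-/

noncomputable section

open Bundle Set Function Filter
open scoped Manifold ContDiff Topology

namespace Literature.Geometry.Manifold

open Literature.Geometry.Lorentzian

section FamilyPullback

variable {EP : Type*} [NormedAddCommGroup EP] [NormedSpace ℝ EP] {HP : Type*} [TopologicalSpace HP]
  {IP : ModelWithCorners ℝ EP HP} {P : Type*} [TopologicalSpace P] [ChartedSpace HP P]
  {E : Type*} [NormedAddCommGroup E] [NormedSpace ℝ E] {H : Type*} [TopologicalSpace H]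
  {I : ModelWithCorners ℝ E H} {M : Type*} [TopologicalSpace M] [ChartedSpace H M]
  {E' : Type*} [NormedAddCommGroup E'] [NormedSpace ℝ E'] {H' : Type*} [TopologicalSpace H']
  {I' : ModelWithCorners ℝ E' H'} {N : Type*} [TopologicalSpace N] [ChartedSpace H' N]
  [IsManifold I' ∞ N] [IsManifold I ∞ M] {n : ℕ∞ω}

/-- **Pulling back a `C^n` FAMILY of fields of bilinear forms along a fixed map between
manifolds.** If `f : N → M` is `C^{n+1}` at `y₀` and the family `(p, x) ↦ (x, s p x)` of fields of
bilinear forms on `TM` is `C^n` at `(p₀, f y₀)` (as a map into `Hom(TM, Hom(TM, ℝ))`), then the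
family of pulled-back fields `(p, y) ↦ (y, (f^*(s p))_y)` is `C^n` at `(p₀, y₀)` as a map into
`Hom(TN, Hom(TN, ℝ))`: in tangent coordinates `f^*(s p) = Φᵀ (β p ∘ f) Φ` with `Φ` the differential
of `f` read in charts (`ContMDiffAt.mfderiv_const`) and `β` the family read in charts
(`contMDiffAt_bilin_iff`). The parametric form of `contMDiff_pullbackBilin_section`.
[cite: ONeill1983, Ch. 3, Def. 3.9 and Lemma 3.35] -/
theorem contMDiffAt_pullbackBilin_familySection {f : N → M} {y₀ : N} {p₀ : P}
    (hf : ContMDiffAt I' I (n + 1) f y₀)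
    {s : P → Π x : M, TangentSpace I x →L[ℝ] TangentSpace I x →L[ℝ] ℝ}
    (hs : ContMDiffAt (IP.prod I) (I.prod 𝓘(ℝ, E →L[ℝ] E →L[ℝ] ℝ)) n
      (fun q : P × M ↦ TotalSpace.mk' (E →L[ℝ] E →L[ℝ] ℝ)
        (E := fun x : M ↦ TangentSpace I x →L[ℝ] TangentSpace I x →L[ℝ] ℝ) q.2 (s q.1 q.2))
      (p₀, f y₀)) :
    ContMDiffAt (IP.prod I') (I'.prod 𝓘(ℝ, E' →L[ℝ] E' →L[ℝ] ℝ)) n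
      (fun q : P × N ↦ TotalSpace.mk' (E' →L[ℝ] E' →L[ℝ] ℝ)
        (E := fun y : N ↦ TangentSpace I' y →L[ℝ] TangentSpace I' y →L[ℝ] ℝ) q.2
        (pullbackBilin (I := I) (I' := I') f (s q.1) q.2)) (p₀, y₀) := by
  rw [contMDiffAt_bilin_iff]
  refine ⟨contMDiffAt_snd, ?_⟩
  set τN := trivializationAt E' (TangentSpace I' : N → Type _) y₀ with hτN
  set τM := trivializationAt E (TangentSpace I : M → Type _) (f y₀) with hτM
  set Φ : N → E' →L[ℝ] E := inTangentCoordinates I' I id f (fun y ↦ mfderiv I' I f y) y₀ with hΦ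
  have hΦs : ContMDiffAt I' 𝓘(ℝ, E' →L[ℝ] E) n Φ y₀ :=
    ContMDiffAt.mfderiv_const hf le_rfl
  have hΦs' : ContMDiffAt (IP.prod I') 𝓘(ℝ, E' →L[ℝ] E) n (fun q : P × N ↦ Φ q.2) (p₀, y₀) :=
    hΦs.comp (p₀, y₀) contMDiffAt_snd
  set β : P × M → E →L[ℝ] E →L[ℝ] ℝ := fun q ↦
    (ContinuousLinearMap.precomp ℝ (τM.symmL ℝ q.2)).comp ((s q.1 q.2).comp (τM.symmL ℝ q.2))
    with hβ
  have hβs : ContMDiffAt (IP.prod I) 𝓘(ℝ, E →L[ℝ] E →L[ℝ] ℝ) n β (p₀, f y₀) :=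
    ((contMDiffAt_bilin_iff (IX := IP.prod I) (IB := I) (V := (TangentSpace I : M → Type _))
      (b := fun q : P × M ↦ q.2) (s := fun q : P × M ↦ s q.1 q.2) (x₀ := (p₀, f y₀))).1 hs).2
  have hf' : ContMDiffAt I' I n f y₀ := hf.of_le le_self_add
  have hpf : ContMDiffAt (IP.prod I') (IP.prod I) n (fun q : P × N ↦ (q.1, f q.2)) (p₀, y₀) :=
    contMDiffAt_fst.prodMk (hf'.comp (p₀, y₀) contMDiffAt_snd)
  have hβf : ContMDiffAt (IP.prod I') 𝓘(ℝ, E →L[ℝ] E →L[ℝ] ℝ) n (fun q : P × N ↦ β (q.1, f q.2))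
      (p₀, y₀) :=
    ContMDiffAt.comp (p₀, y₀) hβs hpf
  have h1 : ContMDiffAt (IP.prod I') 𝓘(ℝ, E' →L[ℝ] E →L[ℝ] ℝ) n
      (fun q : P × N ↦ (β (q.1, f q.2)).comp (Φ q.2)) (p₀, y₀) :=
    ContMDiffAt.clm_comp hβf hΦs'
  have h2 : ContMDiffAt (IP.prod I') 𝓘(ℝ, (E →L[ℝ] ℝ) →L[ℝ] (E' →L[ℝ] ℝ)) n
      (fun q : P × N ↦ (Φ q.2).precomp ℝ) (p₀, y₀) :=
    hΦs'.clm_precomp (F₃ := ℝ)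
  have hcomp : ContMDiffAt (IP.prod I') 𝓘(ℝ, E' →L[ℝ] E' →L[ℝ] ℝ) n
      (fun q : P × N ↦ ((Φ q.2).precomp ℝ).comp ((β (q.1, f q.2)).comp (Φ q.2))) (p₀, y₀) :=
    ContMDiffAt.clm_comp h2 h1
  refine hcomp.congr_of_eventuallyEq ?_
  have hev : ∀ᶠ q : P × N in 𝓝 (p₀, y₀), f q.2 ∈ τM.baseSet := by
    have h1 : ∀ᶠ y in 𝓝 y₀, f y ∈ τM.baseSet :=
      hf.continuousAt.preimage_mem_nhds
        (τM.open_baseSet.mem_nhds (FiberBundle.mem_baseSet_trivializationAt' (f y₀)))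
    exact (continuousAt_snd (p := (p₀, y₀))).eventually h1
  filter_upwards [hev] with q hfy
  ext e e'
  have key : ∀ v : E', τM.symmL ℝ (f q.2) (Φ q.2 v) = mfderiv I' I f q.2 (τN.symmL ℝ q.2 v) := by
    intro v
    simp only [hΦ, inTangentCoordinates, ContinuousLinearMap.inCoordinates,
      ContinuousLinearMap.coe_comp, comp_apply, id_eq]
    exact τM.symmL_continuousLinearMapAt hfy _
  simp only [ContinuousLinearMap.coe_comp, comp_apply, ContinuousLinearMap.precomp_apply,
    pullbackBilin_apply, hβ, key]
  rfl

/-- **Corollary (source a vector space, parameters in a vector space): the pulled-back family is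
`C^n` as a FUNCTION.** For `f : F' → M` from a normed space (`T F' = F'`, identity
trivialisations) `C^{n+1}` at `z₀` and a family `s` of fields of bilinear forms on `TM` which is
`C^n` at `(p₀, f z₀)`, the function `(p, z) ↦ (f^*(s p))_z ∈ F' →L F' →L ℝ` is `C^n` at `(p₀, z₀)`.
[cite: ONeill1983, Ch. 3, Def. 3.9 and Lemma 3.35] -/
theorem contDiffAt_pullbackBilin_familySection {P' : Type*} [NormedAddCommGroup P'] [NormedSpace ℝ P']
    {F' : Type*} [NormedAddCommGroup F'] [NormedSpace ℝ F']
    {f : F' → M} {z₀ : F'} {p₀ : P'} (hf : ContMDiffAt 𝓘(ℝ, F') I (n + 1) f z₀)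
    {s : P' → Π x : M, TangentSpace I x →L[ℝ] TangentSpace I x →L[ℝ] ℝ}
    (hs : ContMDiffAt (𝓘(ℝ, P').prod I) (I.prod 𝓘(ℝ, E →L[ℝ] E →L[ℝ] ℝ)) n
      (fun q : P' × M ↦ TotalSpace.mk' (E →L[ℝ] E →L[ℝ] ℝ)
        (E := fun x : M ↦ TangentSpace I x →L[ℝ] TangentSpace I x →L[ℝ] ℝ) q.2 (s q.1 q.2))
      (p₀, f z₀)) :
    ContDiffAt ℝ n (fun q : P' × F' ↦ (show F' →L[ℝ] F' →L[ℝ] ℝ from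
      pullbackBilin (I := I) (I' := 𝓘(ℝ, F')) f (s q.1) q.2)) (p₀, z₀) := by
  have h := contMDiffAt_pullbackBilin_familySection (IP := 𝓘(ℝ, P')) (I' := 𝓘(ℝ, F')) hf hs
  rw [contMDiffAt_bilin_iff] at h
  obtain ⟨-, h⟩ := h
  have hfun : (fun q : P' × F' ↦ (ContinuousLinearMap.precomp ℝ
      ((trivializationAt F' (TangentSpace 𝓘(ℝ, F') : F' → Type _) z₀).symmL ℝ q.2)).comp
        ((pullbackBilin (I := I) (I' := 𝓘(ℝ, F')) f (s q.1) q.2).comp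
          ((trivializationAt F' (TangentSpace 𝓘(ℝ, F') : F' → Type _) z₀).symmL ℝ q.2))) =
      fun q : P' × F' ↦ (show F' →L[ℝ] F' →L[ℝ] ℝ from
        pullbackBilin (I := I) (I' := 𝓘(ℝ, F')) f (s q.1) q.2) := by
    funext q
    rw [symmL_trivializationAt_self (I := 𝓘(ℝ, F')) z₀ q.2]
    ext v w
    rfl
  rw [hfun] at h
  -- pass from the product model to the vector space `P' × F'`
  have e : ContMDiffAt 𝓘(ℝ, P' × F') (𝓘(ℝ, P').prod 𝓘(ℝ, F')) n (fun q : P' × F' ↦ (q.1, q.2))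
      (p₀, z₀) :=
    (contMDiffAt_iff_contDiffAt.2 contDiffAt_fst).prodMk (contMDiffAt_iff_contDiffAt.2 contDiffAt_snd)
  exact contMDiffAt_iff_contDiffAt.1 (h.comp (p₀, z₀) e)


end FamilyPullback

end Literature.Geometry.Manifold

end
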